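/-
Copyright (c) 2026 the pub-hodgecm-mathlib formalisation cell (harness21).  Prover seat hodgecm-mathlib-K2E3-p11 (g5), Track B «K2-LIT» ∕ h413
(`stmt-HodgeConjecture-24833`), line `K2_E3_EllipticInputs`, unit U12 §L, Richardson road for (LBGL-ge3) at `N = 3` (road owner K2E3-p11), brick (F-E) =
(LBGL-3E) «THE (2,1)-PARABOLIC SLICE DENSITY OF 𝔤𝔩₃(F)», FILE H″1 «THE PIECE INTEGRAL: one level-set piece of `ρ = ∫_K∫_𝔭` is `C·‖χ(m)‖⁻¹·μ𝔤|_{V_j(m)}`».  2026-09-04.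
-/
import Summits.HodgeConjecture.HodgeConjecture.Theorems.K2E3GL3ParabolicSliceLocalPullback   -- ★ G″2 p857881 (this seat): the `(z,r)`-integral `exists_lintegral_pi_parabolicChart_indicator_eq`
import Summits.HodgeConjecture.HodgeConjecture.Theorems.K2E3GL3ParahoricLevelMeasure         -- ★ F″ p857825 (K2E5-p17 g4): `exists_lintegral_glInt_lowerLevel_eq` (`k = (1 + Lz)·p` on the level set)
import Summits.HodgeConjecture.HodgeConjecture.Theorems.K2E3GL3ParabolicLieAdInvariant        -- ★ P″ p857752 (K2E3-p03 g4): `lintegral_pi_comp_conj_parabolic_eq` (`dP` is `Ad(K ∩ P)`-invariant)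
import Literature.NumberTheory.Automorphic.HeckeTransversalGL                                -- ★ `mem_glInt_of_isIntegralMatrix`
import HarnessLib

/-!
# K2_E3 road (h413), §L ∕ Richardson road at `N = 3`, brick (F-E) FILE H″1: the piece integral

Cell `pub/hodgecm-mathlib` (D-0151), Track B, seat K2E3-p11 (g5) (road owner of (F-E) = (LBGL-3E) `sig_K2E3GL3ParabolicSliceDensity`; ROAD v2 on `K2/STATUS.md`,
2026-09-04).  `--supports stmt-HodgeConjecture-24833 --as helper`; THEOREMS ONLY (no definition ∕ instance ∕ notation ∕ named fact ∕ `sorry`); never imports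
`Cruxes/…/Lines`.  COUNT-NEUTRAL.

THE POINT.  For the (2,1)-parabolic slice `ρ(h) = ∫_K ∫_𝔭 h(Ad(k)P) dP dk` (`K = GL₃(𝒪)`, `P(r) = [[r₀,r₁,r₂],[r₃,r₄,r₅],[0,0,r₆]]`) and a `(G,M)`-regular Levi datum
`m` (`χ(m) = χ_A(m₄) ≠ 0`), the contribution of the LEVEL SET `J_{j'} = {k ∈ K | k₂₀, k₂₁ ∈ 𝔭^{j'}}` to `ρ(1_{V_j(m)}·h)` is
  `∫⁻_{k ∈ J_{j'}} ∫⁻_{r ∈ F⁷} (1_{V_j(m)}·h)(Ad(k)P(r)) dr dκ = C · ‖χ(m)‖_F⁻¹ · ∫⁻_{V_j(m)} h dμ𝔤`      (`j₀(m) ≤ j' ≤ j`)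
with ONE constant `C = c_F″ · c_G″` (independent of `m`, `j'`, `j`, `h`).  Three ★ bricks compose: ★ P″ makes `Θ(g) := ∫⁻_r (1_V·h)(g P(r) g⁻¹) dr` right-`(K∩P)`-invariant,
★ F″ turns `∫⁻_{J_{j'}} Θ dκ` into `c_F″ · ∫⁻_{z ∈ (𝔭^{j'})²} Θ(1 + L z) dz`, and ★ G″2 evaluates the `(z, r)`-integral.  Files H″2∕H″3 sum these pieces over the fibre
(one piece at an elliptic `A`, three at a split regular point — ★ EXHAUST), H″6∕H″7 glue them into the leaf.
* `measurable_sliceKernel` (measurability of `Θ`), `sliceKernel_mul_parabolic` (its right-`(K∩P)`-invariance);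
* **`exists_lintegral_levelSet_parabolicSlice_indicator_eq`** (the piece integral).
[HarishChandra1999AdmissibleDistributions, §7 Lemma 7.8] [HarishChandra1970, Part V §4 Lemma 22]
HONEST LABEL: HC_CM is proved only modulo the 7 printed citations (2 remaining named inputs: hLiu418 = stmt-HodgeConjecture-24832, h413 = stmt-HodgeConjecture-24833)
until rung 0 closes; count-neutral helper ((LBGL-ge3)∕(LBGL-3E) NOT ★ here).

## References
* [HarishChandra1999AdmissibleDistributions] Harish-Chandra (DeBacker–Sally), *Admissible Invariant Distributions on Reductive p-adic Groups* (1999), §7, Lemma 7.8.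
* [HarishChandra1970] Harish-Chandra (van Dijk), *Harmonic Analysis on Reductive p-adic Groups*, LNM 162 (1970), Part V §4 Lemma 22.
-/

set_option autoImplicit false
set_option linter.dupNamespace false

noncomputable section

open MeasureTheory Measure Filter Topology Set Matrix ValuativeRel
open scoped MatrixGroups NNReal ENNReal Pointwise
open Literature.NumberTheory.Automorphic Literature.NumberTheory.Automorphic.LocalFieldHaar
open Literature.NumberTheory.GaloisRepresentations Literature.NumberTheory.GaloisRepresentations.IsNonarchimedeanLocalField
open Summit.HodgeConjecture.HodgeConjecture.Cruxes.H413.K2E3GLnMaximalParabolicDescent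
open Summit.HodgeConjecture.HodgeConjecture.Cruxes.H413.K2E3GL3ParabolicOrbitChart
open Summit.HodgeConjecture.HodgeConjecture.Cruxes.H413.K2E3GL3ParabolicSliceLocalPullback

namespace Summit.HodgeConjecture.HodgeConjecture.Cruxes.H413.K2E3GL3ParabolicSlicePieceIntegral

variable {F : Type*} [Field F] [ValuativeRel F] [TopologicalSpace F] [IsNonarchimedeanLocalField F]
  [MeasurableSpace F] [BorelSpace F]
  [MeasurableSpace (Matrix (Fin 3) (Fin 3) F)] [BorelSpace (Matrix (Fin 3) (Fin 3) F)]
  [MeasurableSpace (GL (Fin 3) F)] [BorelSpace (GL (Fin 3) F)]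

omit [MeasurableSpace (GL (Fin 3) F)] [BorelSpace (GL (Fin 3) F)] in
/-- **Measurability of the slice kernel** `Θ(g) = ∫⁻_r φ(g·P(r)·g⁻¹) dr` on `M₃(F)` (`g⁻¹` the matrix inverse `(det g)⁻¹·adj g`, a measurable function of `g`). [folklore] -/
theorem measurable_sliceKernel (dx : Measure F) [dx.IsAddHaarMeasure] {φ : Matrix (Fin 3) (Fin 3) F → ℝ≥0∞} (hφ : Measurable φ) :
    Measurable fun g : Matrix (Fin 3) (Fin 3) F =>
      ∫⁻ r : Fin 7 → F, φ (g * !![r 0, r 1, r 2; r 3, r 4, r 5; 0, 0, r 6] * g⁻¹) ∂(Measure.pi fun _ : Fin 7 => dx) := by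
  haveI : T2Space F := (isLocalField F).toT2Space
  haveI : LocallyCompactSpace F := (isLocalField F).toLocallyCompactSpace
  haveI : SecondCountableTopology F := secondCountableTopology_localField F
  haveI : IsTopologicalRing F := inferInstance
  letI : NontriviallyNormedField F := IsNonarchimedeanLocalField.nontriviallyNormedField F
  haveI : SecondCountableTopology (Matrix (Fin 3) (Fin 3) F) := secondCountableTopology_matrix (F := F) (m := Fin 3) (n := Fin 3)
  -- `g ↦ g⁻¹ = (det g)⁻¹ • adj g` is measurable
  have hinv : Measurable fun g : Matrix (Fin 3) (Fin 3) F => g⁻¹ := by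
    have h1 : Measurable fun g : Matrix (Fin 3) (Fin 3) F => Ring.inverse g.det := by
      have : (fun g : Matrix (Fin 3) (Fin 3) F => Ring.inverse g.det) = fun g => (g.det)⁻¹ := by
        funext g; exact Ring.inverse_eq_inv _
      rw [this]
      exact (continuous_id.matrix_det).measurable.inv
    simp_rw [Matrix.inv_def]
    exact h1.smul (continuous_id.matrix_adjugate).measurable
  have hP : Continuous fun r : Fin 7 → F => (!![r 0, r 1, r 2; r 3, r 4, r 5; 0, 0, r 6] : Matrix (Fin 3) (Fin 3) F) :=
    K2E3GL3ParabolicLieAdInvariant.continuous_parabolic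
  have hf : Measurable fun p : Matrix (Fin 3) (Fin 3) F × (Fin 7 → F) =>
      φ (p.1 * !![p.2 0, p.2 1, p.2 2; p.2 3, p.2 4, p.2 5; 0, 0, p.2 6] * p.1⁻¹) :=
    hφ.comp (((continuous_fst.mul (hP.comp continuous_snd)).measurable).mul (hinv.comp measurable_fst))
  exact hf.lintegral_prod_right'

omit [MeasurableSpace (Matrix (Fin 3) (Fin 3) F)] [BorelSpace (Matrix (Fin 3) (Fin 3) F)] [MeasurableSpace (GL (Fin 3) F)] [BorelSpace (GL (Fin 3) F)] in
/-- **Right-`(K∩P)`-invariance of the slice kernel**: for `p ∈ M₃(𝒪)` with `‖det p‖ = 1` and `p₂₀ = p₂₁ = 0`, `Θ(g·p) = Θ(g)` — `Ad(p)` preserves `dP` (★ P″). [cite: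
HarishChandra1999AdmissibleDistributions, §7 Lemma 7.8] -/
theorem sliceKernel_mul_parabolic (dx : Measure F) [dx.IsAddHaarMeasure] (φ : Matrix (Fin 3) (Fin 3) F → ℝ≥0∞)
    (g p : Matrix (Fin 3) (Fin 3) F) (hp : ∀ i l, p i l ∈ 𝒪[F]) (hdet : normAbs F p.det = 1) (h20 : p 2 0 = 0) (h21 : p 2 1 = 0) :
    ∫⁻ r : Fin 7 → F, φ (g * p * !![r 0, r 1, r 2; r 3, r 4, r 5; 0, 0, r 6] * (g * p)⁻¹) ∂(Measure.pi fun _ : Fin 7 => dx) =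
      ∫⁻ r : Fin 7 → F, φ (g * !![r 0, r 1, r 2; r 3, r 4, r 5; 0, 0, r 6] * g⁻¹) ∂(Measure.pi fun _ : Fin 7 => dx) := by
  have hdet0 : p.det ≠ 0 := by
    intro h0; rw [h0, map_zero] at hdet; exact zero_ne_one hdet
  set p' : GL (Fin 3) F := Matrix.GeneralLinearGroup.mkOfDetNeZero p hdet0 with hp'
  have hcoe : (p' : Matrix (Fin 3) (Fin 3) F) = p := rfl
  have hmem : p' ∈ glInt 3 F :=
    mem_glInt_of_isIntegralMatrix (fun i l => hp i l) (by rw [hcoe, ← normAbs_eq_one_iff_valuation_eq_one]; exact hdet)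
  have h := K2E3GL3ParabolicLieAdInvariant.lintegral_pi_comp_conj_parabolic_eq dx hmem (by rw [hcoe]; exact h20) (by rw [hcoe]; exact h21)
    (fun Y => φ (g * Y * g⁻¹))
  simp only [hcoe, Matrix.coe_units_inv] at h
  rw [← h]
  refine lintegral_congr fun r => ?_
  rw [Matrix.mul_inv_rev g p]
  simp only [Matrix.mul_assoc]

/-- **THE PIECE INTEGRAL.**  `κ` a Haar measure on `K = GL₃(𝒪)`, `dx` an additive Haar measure on `F`, `μ𝔤` one on `𝔤𝔩₃(F)`.  There is ONE constant `C ∈ (0, ∞)` such that for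
every `(G,M)`-regular Levi datum `m` (`χ(m) ≠ 0`) there is a depth `j₀` with: for all `j₀ ≤ j' ≤ j` and every measurable `h ≥ 0`,
`∫⁻_{k ∈ K, k₂₀, k₂₁ ∈ 𝔭^{j'}} ∫⁻_{r ∈ F⁷} (1_{V_j(m)}·h)(k·P(r)·k⁻¹) dr dκ = C · ‖χ(m)‖_F⁻¹ · ∫⁻_{V_j(m)} h dμ𝔤`,
`V_j(m) = M(m) + e_m(M₃(𝔭^j))` (★ E″2).  Proof: ★ F″ (`k = (1 + L z)·p` on the level set; the kernel is right-`(K∩P)`-invariant by ★ P″) then ★ G″2.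
[cite: HarishChandra1999AdmissibleDistributions, §7 Lemma 7.8] [cite: HarishChandra1970, Part V §4 Lemma 22] -/
theorem exists_lintegral_levelSet_parabolicSlice_indicator_eq (κ : Measure ↥(glInt 3 F)) [IsHaarMeasure κ] (dx : Measure F) [dx.IsAddHaarMeasure]
    (μ𝔤 : Measure (Matrix (Fin 3) (Fin 3) F)) [μ𝔤.IsAddHaarMeasure] :
    ∃ C : ℝ≥0∞, C ≠ 0 ∧ C ≠ ⊤ ∧ ∀ m : Fin 5 → F, (!![m 0, m 1; m 2, m 3] : Matrix (Fin 2) (Fin 2) F).charpoly.eval (m 4) ≠ 0 →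
      ∃ j₀ : ℕ, ∀ j' j : ℕ, j₀ ≤ j' → j' ≤ j → ∀ h : Matrix (Fin 3) (Fin 3) F → ℝ≥0∞, Measurable h →
        ∫⁻ k in {k : ↥(glInt 3 F) | ((k : GL (Fin 3) F) : Matrix (Fin 3) (Fin 3) F) 2 0 ∈ primePowBall F j' ∧
            ((k : GL (Fin 3) F) : Matrix (Fin 3) (Fin 3) F) 2 1 ∈ primePowBall F j'},
          ∫⁻ r : Fin 7 → F,
            ((!![m 0, m 1, 0; m 2, m 3, 0; 0, 0, m 4] : Matrix (Fin 3) (Fin 3) F) +ᵥ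
              ((fun X : Matrix (Fin 3) (Fin 3) F =>
                  (!![X 0 0, X 0 1, X 0 2; X 1 0, X 1 1, X 1 2; X 2 0 * (m 0 - m 4) + X 2 1 * m 2, X 2 0 * m 1 + X 2 1 * (m 3 - m 4), X 2 2] :
                    Matrix (Fin 3) (Fin 3) F)) '' {X : Matrix (Fin 3) (Fin 3) F | ∀ i l, X i l ∈ primePowBall F j})).indicator h
              (((k : GL (Fin 3) F) : Matrix (Fin 3) (Fin 3) F) * !![r 0, r 1, r 2; r 3, r 4, r 5; 0, 0, r 6] *
                ((((k : GL (Fin 3) F))⁻¹ : GL (Fin 3) F) : Matrix (Fin 3) (Fin 3) F))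
            ∂(Measure.pi fun _ : Fin 7 => dx) ∂κ =
          C * ((normAbs F ((!![m 0, m 1; m 2, m 3] : Matrix (Fin 2) (Fin 2) F).charpoly.eval (m 4)))⁻¹ : ℝ≥0) *
            ∫⁻ X in (!![m 0, m 1, 0; m 2, m 3, 0; 0, 0, m 4] : Matrix (Fin 3) (Fin 3) F) +ᵥ
              ((fun X : Matrix (Fin 3) (Fin 3) F =>
                  (!![X 0 0, X 0 1, X 0 2; X 1 0, X 1 1, X 1 2; X 2 0 * (m 0 - m 4) + X 2 1 * m 2, X 2 0 * m 1 + X 2 1 * (m 3 - m 4), X 2 2] :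
                    Matrix (Fin 3) (Fin 3) F)) '' {X : Matrix (Fin 3) (Fin 3) F | ∀ i l, X i l ∈ primePowBall F j}), h X ∂μ𝔤 := by
  classical
  obtain ⟨cF, hcF0, hcFtop, hF⟩ := K2E3GL3ParahoricLevelMeasure.exists_lintegral_glInt_lowerLevel_eq (F := F) κ dx
  obtain ⟨c, hc0, hctop, hG⟩ := exists_lintegral_pi_parabolicChart_indicator_eq (F := F) μ𝔤 dx
  refine ⟨cF * c, mul_ne_zero hcF0 hc0, ENNReal.mul_ne_top hcFtop hctop, fun m hm => ?_⟩
  obtain ⟨j₀, hj₀⟩ := hG m hm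
  -- openness (hence measurability) of `V_j(m)` from ★ E″2
  set Φ : Matrix (Fin 3) (Fin 3) F → Matrix (Fin 3) (Fin 3) F := fun X : Matrix (Fin 3) (Fin 3) F =>
    (1 + (!![0, 0, 0; 0, 0, 0; X 2 0, X 2 1, 0] : Matrix (Fin 3) (Fin 3) F)) *
      (!![m 0, m 1, 0; m 2, m 3, 0; 0, 0, m 4] + !![X 0 0, X 0 1, X 0 2; X 1 0, X 1 1, X 1 2; 0, 0, X 2 2]) *
      (1 - !![0, 0, 0; 0, 0, 0; X 2 0, X 2 1, 0]) with hΦ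
  obtain ⟨k₀, hk₀⟩ := exists_depth_parabolicChart m hm μ𝔤 Φ hΦ
  refine ⟨max (max j₀ k₀) 1, fun j' j hj' hjj h hh => ?_⟩
  obtain ⟨-, himgj, hopenj, -, -, -⟩ := hk₀ j (by omega)
  set V : Set (Matrix (Fin 3) (Fin 3) F) := (!![m 0, m 1, 0; m 2, m 3, 0; 0, 0, m 4] : Matrix (Fin 3) (Fin 3) F) +ᵥ
      ((fun X : Matrix (Fin 3) (Fin 3) F =>
          (!![X 0 0, X 0 1, X 0 2; X 1 0, X 1 1, X 1 2; X 2 0 * (m 0 - m 4) + X 2 1 * m 2, X 2 0 * m 1 + X 2 1 * (m 3 - m 4), X 2 2] :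
            Matrix (Fin 3) (Fin 3) F)) '' {X : Matrix (Fin 3) (Fin 3) F | ∀ i l, X i l ∈ primePowBall F j}) with hV
  have hVm : MeasurableSet V := by rw [← himgj]; exact hopenj.measurableSet
  -- the slice kernel `Θ`
  set Θ : Matrix (Fin 3) (Fin 3) F → ℝ≥0∞ := fun g =>
    ∫⁻ r : Fin 7 → F, V.indicator h (g * !![r 0, r 1, r 2; r 3, r 4, r 5; 0, 0, r 6] * g⁻¹) ∂(Measure.pi fun _ : Fin 7 => dx) with hΘ
  have hΘm : Measurable Θ := measurable_sliceKernel dx (hh.indicator hVm)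
  have hΘinv : ∀ g p : Matrix (Fin 3) (Fin 3) F, (∀ i l, p i l ∈ 𝒪[F]) → normAbs F p.det = 1 → p 2 0 = 0 → p 2 1 = 0 → Θ (g * p) = Θ g :=
    fun g p hp hdet h20 h21 => sliceKernel_mul_parabolic dx (V.indicator h) g p hp hdet h20 h21
  -- ★ F″ on the level set, then ★ G″2 on the `(z, r)`-integral
  have h1 := hF j' (by omega) Θ hΘm hΘinv
  have h2 := hj₀ j' j (by omega) hjj h hh
  have hLHS : ∫⁻ k in {k : ↥(glInt 3 F) | ((k : GL (Fin 3) F) : Matrix (Fin 3) (Fin 3) F) 2 0 ∈ primePowBall F j' ∧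
        ((k : GL (Fin 3) F) : Matrix (Fin 3) (Fin 3) F) 2 1 ∈ primePowBall F j'},
      ∫⁻ r : Fin 7 → F, V.indicator h (((k : GL (Fin 3) F) : Matrix (Fin 3) (Fin 3) F) * !![r 0, r 1, r 2; r 3, r 4, r 5; 0, 0, r 6] *
        ((((k : GL (Fin 3) F))⁻¹ : GL (Fin 3) F) : Matrix (Fin 3) (Fin 3) F)) ∂(Measure.pi fun _ : Fin 7 => dx) ∂κ =
      ∫⁻ k in {k : ↥(glInt 3 F) | ((k : GL (Fin 3) F) : Matrix (Fin 3) (Fin 3) F) 2 0 ∈ primePowBall F j' ∧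
        ((k : GL (Fin 3) F) : Matrix (Fin 3) (Fin 3) F) 2 1 ∈ primePowBall F j'}, Θ ((k : GL (Fin 3) F) : Matrix (Fin 3) (Fin 3) F) ∂κ := by
    refine lintegral_congr fun k => ?_
    simp only [hΘ, Matrix.coe_units_inv]
  rw [hLHS, h1]
  change cF * ∫⁻ z in Set.univ.pi (fun _ : Fin 2 => primePowBall F (j' : ℤ)), ∫⁻ r : Fin 7 → F,
      V.indicator h ((1 + !![0, 0, 0; 0, 0, 0; z 0, z 1, 0]) * !![r 0, r 1, r 2; r 3, r 4, r 5; 0, 0, r 6] * (1 + !![0, 0, 0; 0, 0, 0; z 0, z 1, 0])⁻¹)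
      ∂(Measure.pi fun _ : Fin 7 => dx) ∂(Measure.pi fun _ : Fin 2 => dx) = _
  rw [h2, ← mul_assoc, ← mul_assoc]

omit [MeasurableSpace F] [BorelSpace F] [MeasurableSpace (Matrix (Fin 3) (Fin 3) F)] [BorelSpace (Matrix (Fin 3) (Fin 3) F)]
  [MeasurableSpace (GL (Fin 3) F)] [BorelSpace (GL (Fin 3) F)] in
/-- A bound `c₂ ∈ ℕ` with `x⁻¹ ∈ 𝔭^{−c₂}`. [folklore] -/
theorem exists_inv_mem_primePowBall_neg (x : F) : ∃ c : ℕ, x⁻¹ ∈ primePowBall F (-(c : ℤ)) := by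
  obtain ⟨k, hk⟩ := exists_mem_primePowBall x⁻¹
  refine ⟨(-k).toNat, primePowBall_antitone ?_ hk⟩
  have h2 : -k ≤ ((-k).toNat : ℤ) := Int.self_le_toNat _
  omega

omit [MeasurableSpace F] [BorelSpace F] [MeasurableSpace (Matrix (Fin 3) (Fin 3) F)] [BorelSpace (Matrix (Fin 3) (Fin 3) F)]
  [MeasurableSpace (GL (Fin 3) F)] [BorelSpace (GL (Fin 3) F)] in
/-- **Balls sit inside the chart image**: if `m ∈ (𝔭^{−c₀})⁵`, `χ(m)⁻¹ ∈ 𝔭^{−c₂}` and `j + c₀ + c₂ ≤ J`, then `M(m) + M₃(𝔭^J) ⊆ V_j(m) = M(m) + e_m(M₃(𝔭^j))` (invert the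
row action: `(y₀, y₁) ↦ χ⁻¹·(y₀, y₁)·adj(A − m₄·1)`). [folklore] -/
theorem ball_subset_imageRowAction {m : Fin 5 → F} (hm : (!![m 0, m 1; m 2, m 3] : Matrix (Fin 2) (Fin 2) F).charpoly.eval (m 4) ≠ 0)
    {c₀ c₂ : ℕ} (hc₀ : ∀ i, m i ∈ primePowBall F (-(c₀ : ℤ)))
    (hc₂ : ((!![m 0, m 1; m 2, m 3] : Matrix (Fin 2) (Fin 2) F).charpoly.eval (m 4))⁻¹ ∈ primePowBall F (-(c₂ : ℤ)))
    {j J : ℕ} (hjJ : j + c₀ + c₂ ≤ J) :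
    {X : Matrix (Fin 3) (Fin 3) F | ∀ i l, (X - !![m 0, m 1, 0; m 2, m 3, 0; 0, 0, m 4]) i l ∈ primePowBall F (J : ℤ)} ⊆
      (!![m 0, m 1, 0; m 2, m 3, 0; 0, 0, m 4] : Matrix (Fin 3) (Fin 3) F) +ᵥ
        ((fun X : Matrix (Fin 3) (Fin 3) F =>
            (!![X 0 0, X 0 1, X 0 2; X 1 0, X 1 1, X 1 2; X 2 0 * (m 0 - m 4) + X 2 1 * m 2, X 2 0 * m 1 + X 2 1 * (m 3 - m 4), X 2 2] :
              Matrix (Fin 3) (Fin 3) F)) '' {X : Matrix (Fin 3) (Fin 3) F | ∀ i l, X i l ∈ primePowBall F j}) := by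
  intro X hX
  set χ : F := (!![m 0, m 1; m 2, m 3] : Matrix (Fin 2) (Fin 2) F).charpoly.eval (m 4) with hχdef
  have hχ : χ = (m 4 - m 0) * (m 4 - m 3) - m 1 * m 2 := K2E3GL3ParabolicNilTwist.eval_charpoly_fin_two m
  set Y : Matrix (Fin 3) (Fin 3) F := X - !![m 0, m 1, 0; m 2, m 3, 0; 0, 0, m 4] with hY
  -- the preimage `Y'` of `Y` under the row action
  set Y' : Matrix (Fin 3) (Fin 3) F := !![Y 0 0, Y 0 1, Y 0 2; Y 1 0, Y 1 1, Y 1 2;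
    χ⁻¹ * (Y 2 0 * (m 3 - m 4) - Y 2 1 * m 2), χ⁻¹ * (-(Y 2 0 * m 1) + Y 2 1 * (m 0 - m 4)), Y 2 2] with hY'
  have hlin3 : χ⁻¹ * (Y 2 0 * (m 3 - m 4) - Y 2 1 * m 2) * (m 0 - m 4) + χ⁻¹ * (-(Y 2 0 * m 1) + Y 2 1 * (m 0 - m 4)) * m 2 = Y 2 0 := by
    have : χ⁻¹ * (Y 2 0 * (m 3 - m 4) - Y 2 1 * m 2) * (m 0 - m 4) + χ⁻¹ * (-(Y 2 0 * m 1) + Y 2 1 * (m 0 - m 4)) * m 2 = χ⁻¹ * (χ * Y 2 0) := by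
      rw [hχ]; ring
    rw [this, ← mul_assoc, inv_mul_cancel₀ hm, one_mul]
  have hlin4 : χ⁻¹ * (Y 2 0 * (m 3 - m 4) - Y 2 1 * m 2) * m 1 + χ⁻¹ * (-(Y 2 0 * m 1) + Y 2 1 * (m 0 - m 4)) * (m 3 - m 4) = Y 2 1 := by
    have : χ⁻¹ * (Y 2 0 * (m 3 - m 4) - Y 2 1 * m 2) * m 1 + χ⁻¹ * (-(Y 2 0 * m 1) + Y 2 1 * (m 0 - m 4)) * (m 3 - m 4) = χ⁻¹ * (χ * Y 2 1) := by
      rw [hχ]; ring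
    rw [this, ← mul_assoc, inv_mul_cancel₀ hm, one_mul]
  have hRA : (!![Y' 0 0, Y' 0 1, Y' 0 2; Y' 1 0, Y' 1 1, Y' 1 2; Y' 2 0 * (m 0 - m 4) + Y' 2 1 * m 2, Y' 2 0 * m 1 + Y' 2 1 * (m 3 - m 4), Y' 2 2] :
      Matrix (Fin 3) (Fin 3) F) = Y := by
    ext i l; fin_cases i <;> fin_cases l
    all_goals simp only [hY', Matrix.of_apply, Matrix.cons_val', Matrix.cons_val_zero, Matrix.cons_val_one, Matrix.cons_val_two,
      Matrix.cons_val_fin_one, Matrix.empty_val', Matrix.tail_cons, Matrix.head_cons, Nat.succ_eq_add_one, Nat.reduceAdd,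
      Fin.isValue, Fin.mk_one, Fin.reduceFinMk, Fin.zero_eta]
    all_goals first | rfl | exact hlin3 | exact hlin4
  -- `Y' ∈ M₃(𝔭^j)`
  have hsub : ∀ a b : Fin 5, m a - m b ∈ primePowBall F (-(c₀ : ℤ)) := fun a b => by
    rw [sub_eq_add_neg]; exact add_mem_primePowBall (hc₀ a) (neg_mem_primePowBall (hc₀ b))
  have hjle : (j : ℤ) ≤ (J : ℤ) := by omega
  have hjle' : (j : ℤ) ≤ -(c₂ : ℤ) + ((J : ℤ) + -(c₀ : ℤ)) := by omega
  have h20 : χ⁻¹ * (Y 2 0 * (m 3 - m 4) - Y 2 1 * m 2) ∈ primePowBall F (j : ℤ) := by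
    refine primePowBall_antitone hjle' (mul_mem_primePowBall hc₂ ?_)
    rw [sub_eq_add_neg]
    exact add_mem_primePowBall (mul_mem_primePowBall (hX 2 0) (hsub 3 4)) (neg_mem_primePowBall (mul_mem_primePowBall (hX 2 1) (hc₀ 2)))
  have h21 : χ⁻¹ * (-(Y 2 0 * m 1) + Y 2 1 * (m 0 - m 4)) ∈ primePowBall F (j : ℤ) := by
    refine primePowBall_antitone hjle' (mul_mem_primePowBall hc₂ ?_)
    exact add_mem_primePowBall (neg_mem_primePowBall (mul_mem_primePowBall (hX 2 0) (hc₀ 1))) (mul_mem_primePowBall (hX 2 1) (hsub 0 4))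
  have hY'box : ∀ i l, Y' i l ∈ primePowBall F j := by
    intro i l; fin_cases i <;> fin_cases l
    all_goals first | exact h20 | exact h21 | exact primePowBall_antitone hjle (hX _ _)
  refine Set.mem_vadd_set.2 ⟨Y, ⟨Y', hY'box, hRA⟩, ?_⟩
  rw [hY, vadd_eq_add, add_sub_cancel]

/-- **THE PIECE INTEGRAL ON A BALL.**  Same constant `C` as `exists_lintegral_levelSet_parabolicSlice_indicator_eq`; for every `(G,M)`-regular `m` there are `j₀, c₁` with:
for all levels `j' ≥ j₀` and ball depths `J ≥ j' + c₁`, and every measurable `h ≥ 0`,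
`∫⁻_{k ∈ K, k₂₀, k₂₁ ∈ 𝔭^{j'}} ∫⁻_r (1_{B_J(m)}·h)(k·P(r)·k⁻¹) dr dκ = C · ‖χ(m)‖_F⁻¹ · ∫⁻_{B_J(m)} h dμ𝔤`, `B_J(m) = M(m) + M₃(𝔭^J)` (the ball sits inside
`V_{J−c₁}(m)`).  H″2∕H″3 sum these pieces over the fibre given by ★ EXHAUST. [cite: HarishChandra1999AdmissibleDistributions, §7 Lemma 7.8] -/
theorem exists_lintegral_levelSet_ball_indicator_eq (κ : Measure ↥(glInt 3 F)) [IsHaarMeasure κ] (dx : Measure F) [dx.IsAddHaarMeasure]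
    (μ𝔤 : Measure (Matrix (Fin 3) (Fin 3) F)) [μ𝔤.IsAddHaarMeasure] :
    ∃ C : ℝ≥0∞, C ≠ 0 ∧ C ≠ ⊤ ∧ ∀ m : Fin 5 → F, (!![m 0, m 1; m 2, m 3] : Matrix (Fin 2) (Fin 2) F).charpoly.eval (m 4) ≠ 0 →
      ∃ j₀ c₁ : ℕ, ∀ j' J : ℕ, j₀ ≤ j' → j' + c₁ ≤ J → ∀ h : Matrix (Fin 3) (Fin 3) F → ℝ≥0∞, Measurable h →
        ∫⁻ k in {k : ↥(glInt 3 F) | ((k : GL (Fin 3) F) : Matrix (Fin 3) (Fin 3) F) 2 0 ∈ primePowBall F j' ∧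
            ((k : GL (Fin 3) F) : Matrix (Fin 3) (Fin 3) F) 2 1 ∈ primePowBall F j'},
          ∫⁻ r : Fin 7 → F,
            ({X : Matrix (Fin 3) (Fin 3) F | ∀ i l, (X - !![m 0, m 1, 0; m 2, m 3, 0; 0, 0, m 4]) i l ∈ primePowBall F (J : ℤ)}).indicator h
              (((k : GL (Fin 3) F) : Matrix (Fin 3) (Fin 3) F) * !![r 0, r 1, r 2; r 3, r 4, r 5; 0, 0, r 6] *
                ((((k : GL (Fin 3) F))⁻¹ : GL (Fin 3) F) : Matrix (Fin 3) (Fin 3) F))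
            ∂(Measure.pi fun _ : Fin 7 => dx) ∂κ =
          C * ((normAbs F ((!![m 0, m 1; m 2, m 3] : Matrix (Fin 2) (Fin 2) F).charpoly.eval (m 4)))⁻¹ : ℝ≥0) *
            ∫⁻ X in {X : Matrix (Fin 3) (Fin 3) F | ∀ i l, (X - !![m 0, m 1, 0; m 2, m 3, 0; 0, 0, m 4]) i l ∈ primePowBall F (J : ℤ)}, h X ∂μ𝔤 := by
  classical
  haveI : T2Space F := (isLocalField F).toT2Space
  haveI : IsTopologicalRing F := inferInstance
  obtain ⟨C, hC0, hCtop, hC⟩ := exists_lintegral_levelSet_parabolicSlice_indicator_eq (F := F) κ dx μ𝔤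
  refine ⟨C, hC0, hCtop, fun m hm => ?_⟩
  obtain ⟨j₀, hj₀⟩ := hC m hm
  obtain ⟨c₀, hc₀⟩ := K2E3GL3ParabolicChartBoxes.exists_forall_mem_primePowBall_neg m
  obtain ⟨c₂, hc₂⟩ := exists_inv_mem_primePowBall_neg ((!![m 0, m 1; m 2, m 3] : Matrix (Fin 2) (Fin 2) F).charpoly.eval (m 4))
  refine ⟨j₀, c₀ + c₂, fun j' J hj' hJ h hh => ?_⟩
  -- the chart level `j := J − c₀ − c₂ ≥ j'` and the ball `B ⊆ V_j(m)`
  obtain ⟨j, hj⟩ : ∃ j : ℕ, j + c₀ + c₂ = J := ⟨J - c₀ - c₂, by omega⟩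
  set M₀ : Matrix (Fin 3) (Fin 3) F := !![m 0, m 1, 0; m 2, m 3, 0; 0, 0, m 4] with hM₀
  set B : Set (Matrix (Fin 3) (Fin 3) F) := {X : Matrix (Fin 3) (Fin 3) F | ∀ i l, (X - M₀) i l ∈ primePowBall F (J : ℤ)} with hB
  set V : Set (Matrix (Fin 3) (Fin 3) F) := M₀ +ᵥ ((fun X : Matrix (Fin 3) (Fin 3) F =>
      (!![X 0 0, X 0 1, X 0 2; X 1 0, X 1 1, X 1 2; X 2 0 * (m 0 - m 4) + X 2 1 * m 2, X 2 0 * m 1 + X 2 1 * (m 3 - m 4), X 2 2] :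
        Matrix (Fin 3) (Fin 3) F)) '' {X : Matrix (Fin 3) (Fin 3) F | ∀ i l, X i l ∈ primePowBall F j}) with hV
  have hBV : B ⊆ V := ball_subset_imageRowAction hm hc₀ hc₂ (le_of_eq hj)
  have hBm : MeasurableSet B := by
    have hcont : Continuous fun X : Matrix (Fin 3) (Fin 3) F => X - M₀ := continuous_id.sub continuous_const
    have : B = ⋂ i, ⋂ l, (fun X : Matrix (Fin 3) (Fin 3) F => (X - M₀) i l) ⁻¹' primePowBall F (J : ℤ) := by
      ext X; simp only [hB, Set.mem_setOf_eq, Set.mem_iInter, Set.mem_preimage]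
    rw [this]
    exact MeasurableSet.iInter fun i => MeasurableSet.iInter fun l =>
      (measurableSet_primePowBall (F := F) _).preimage (hcont.matrix_elem i l).measurable
  -- `1_B·h = 1_V·(1_B·h)` pointwise
  have hind : ∀ Y : Matrix (Fin 3) (Fin 3) F, B.indicator h Y = V.indicator (B.indicator h) Y := by
    intro Y
    by_cases hY : Y ∈ B
    · rw [Set.indicator_of_mem (hBV hY)]
    · rw [Set.indicator_of_notMem hY]
      by_cases hYV : Y ∈ V
      · rw [Set.indicator_of_mem hYV, Set.indicator_of_notMem hY]
      · rw [Set.indicator_of_notMem hYV]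
  have h1 := hj₀ j' j hj' (by omega) (B.indicator h) (hh.indicator hBm)
  have hL : ∫⁻ k in {k : ↥(glInt 3 F) | ((k : GL (Fin 3) F) : Matrix (Fin 3) (Fin 3) F) 2 0 ∈ primePowBall F j' ∧
        ((k : GL (Fin 3) F) : Matrix (Fin 3) (Fin 3) F) 2 1 ∈ primePowBall F j'},
      ∫⁻ r : Fin 7 → F, B.indicator h (((k : GL (Fin 3) F) : Matrix (Fin 3) (Fin 3) F) * !![r 0, r 1, r 2; r 3, r 4, r 5; 0, 0, r 6] *
        ((((k : GL (Fin 3) F))⁻¹ : GL (Fin 3) F) : Matrix (Fin 3) (Fin 3) F)) ∂(Measure.pi fun _ : Fin 7 => dx) ∂κ =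
      ∫⁻ k in {k : ↥(glInt 3 F) | ((k : GL (Fin 3) F) : Matrix (Fin 3) (Fin 3) F) 2 0 ∈ primePowBall F j' ∧
        ((k : GL (Fin 3) F) : Matrix (Fin 3) (Fin 3) F) 2 1 ∈ primePowBall F j'},
      ∫⁻ r : Fin 7 → F, V.indicator (B.indicator h) (((k : GL (Fin 3) F) : Matrix (Fin 3) (Fin 3) F) * !![r 0, r 1, r 2; r 3, r 4, r 5; 0, 0, r 6] *
        ((((k : GL (Fin 3) F))⁻¹ : GL (Fin 3) F) : Matrix (Fin 3) (Fin 3) F)) ∂(Measure.pi fun _ : Fin 7 => dx) ∂κ :=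
    lintegral_congr fun k => lintegral_congr fun r => hind _
  rw [hL, h1, lintegral_indicator hBm, Measure.restrict_restrict hBm, Set.inter_eq_left.2 hBV]

end Summit.HodgeConjecture.HodgeConjecture.Cruxes.H413.K2E3GL3ParabolicSlicePieceIntegral

end
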